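/-
Copyright (c) 2026 the pub-hodgecm-mathlib formalisation cell (harness21).  Prover seat hodgecm-mathlib-F0P3a-p08 (g20): road «S3-ram» (LEAD F0P3a-plan (g13);
owner F0P3a-p06 (g15)), (T2) G-side organ (Cnt2′) (chair F0P3a-p07 (g14)), ROW SOCKET `T2G_reg` — organ (D) of the lattice PARENT LAW «q · n_reg = n_bd»; 2026-09-02.
-/
import Literature.NumberTheory.Automorphic.UnitaryLatticeTreeFixedGrandchildFrameRamified   -- ★ (F0P2-p01 (g15)): `exists_frame_of_adj_adj`, `latticeGraphIso_root_eq_of_mem_unitaryInt`; brings ★ FILE H `map_sub_one_childLatt_le_scaleLattice_pred_iff`, ★ `map_pow_le_scaleLattice_latticeGraphIso_root_iff`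
import Literature.NumberTheory.Automorphic.UnitaryLatticeTreeEvenDepthRankRamified           -- ★ p847392 (F0P2-p01 (g15)): `v_coe_sub_one_rev_apply_le_of_even` (the residual corner vanishes at even depth)
import Literature.NumberTheory.Automorphic.UnitaryLatticeTreeResidualDatumRamified          -- ★ G3⁵: `map_pow_le_scaleLattice_latticeGraphIso_root_iff` (tokens at `u·L₀` ↔ entries of `u⁻¹γu − 1`)
import Literature.NumberTheory.Automorphic.UnitaryLatticeTreeSelfDualTransitiveTame          -- ★ `exists_latticeGraphIso_root_eq_of_v_two` (`v = u·L₀`)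
import Literature.NumberTheory.Automorphic.UnitaryLatticeTreeFixedVertex                     -- ★ `scaleLattice_scaleLattice`, `scaleLattice_le_self_of_v_le_one`, `scaleLattice_mono`
import HarnessLib

/-!
# The lattice graph of a hermitian space — LEVEL TWO AT A SELF-DUAL VERTEX FORCES LEVEL ONE AT EVERY VERTEX AT DISTANCE TWO (tame-ramified place)
# (Bruhat–Tits 1972 §10; Tits 1979 §3.5; Kottwitz 1986 §3)

Topic `NumberTheory/Automorphic`; namespace `Literature.NumberTheory.Automorphic.UnitaryLatticeTree`.  THEOREMS ONLY (no definition, no instance, no notation, no named fact,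
no `sorry`); kernel lane `--supports stmt-HodgeConjecture-24833`.  Cell `pub/hodgecm-mathlib` (D-0151), crux H413; road «S3-ram» (Literature seeding, count-neutral); (T2)
G-side organ (Cnt2′) of the fold (chair F0P3a-p07 (g14)), ROW SOCKET `T2G_reg` (this seat), organ **(D)** of the lattice PARENT LAW «`q · n_reg = n_bd`» (statement-first
`UnitaryLatticeTreeFixedParentLawRamified`, HOME `F0/P3a/F0P3a-p08/g20/reg/`): it is the half «a `bd` vertex never hangs under a vertex of depth `≥ 2`».  J₀-MODEL, datum:
`σ` a valuation-preserving involution with `σϖ = −ϖ`, residually trivial, residue characteristic `≠ 2`.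

THE STATEMENT.  For `γ ∈ U(σ, J₀)` and a self-dual vertex `v` with **`(γ − 1)·v ⊆ ϖ²·v`** (`LEV[v](ϖ²)`), every vertex `w` at distance `≤ 2` from `v` through a neighbour
`c` (`v ~ c ~ w`) satisfies **`(γ − 1)·w ⊆ ϖ·w`** (`LEV[w] ϖ`).  No fixedness hypothesis is needed (every such `w` is in fact fixed).

THE PROOF.  `v = u·L₀` (★ transitivity); if `w = v` this is monotonicity of the level token.  Otherwise `c = (uκ)·N₁`, `w = latt((uκ)·g(a,b))` for some `κ ∈ K₀`, `|a| = 1`,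
`|b| ≤ 1` (★ `exists_frame_of_adj_adj`); `M := (uκ)⁻¹(γ − 1)(uκ)` has all entries `≤ |ϖ|²` (the token `LEV[v](ϖ²)` in the frame `uκ`, ★ `map_pow_le_scaleLattice_latticeGraphIso_root_iff`),
and since `(uκ)⁻¹γ(uκ) ∈ U(σ, J₀)` is `ϖ²`-close to `1` with `2` EVEN, its residual matrix is `J₀`-alternating, so the CORNER `M₂₀` is `≤ |ϖ|³` (★ `v_coe_sub_one_rev_apply_le_of_even`
at `d = 2`, `i = 0`); ★ FILE H `map_sub_one_childLatt_le_scaleLattice_pred_iff` (`d = 2`): the level of `γ` at the child frame `(uκ)·g(a,b)` is `≥ ϖ^{d−1} = ϖ` iff the corner is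
`≤ |ϖ|^{d+1}` — which it is.  (This is the «drop is always `1` at even depth» line of ★ `UnitaryLatticeTreeFixedChildLevelRamified`'s docstring, typed at `d = 2`.)

* **`map_sub_one_le_scaleLattice_of_adj_adj_of_lev_sq`** (organ (D)).

HONEST LABEL: HC_CM is proved only modulo the 2 remaining named inputs (hLiu418 24832, h413 24833) until rung 0 closes; nothing printed is asserted here (elementary lattice
bookkeeping over a valuation ring); «S3-ram» has no books consequence.

## References
* [BruhatTits1972] F. Bruhat, J. Tits, *Groupes réductifs sur un corps local I*, Publ. Math. IHÉS 41 (1972), §10 (lattice models; vertex stabilisers and their filtrations).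
* [Tits1979] J. Tits, *Reductive groups over local fields*, PSPM 33.1 (1979), §3.5 (congruence filtration; reduction mod `𝔭`).
* [Kottwitz1986] R. E. Kottwitz, *Base change for unit elements of Hecke algebras*, Compositio Math. 60 (1986), §3 (levels of fixed lattices, shell by shell).
* [Serre1980Trees] J.-P. Serre, *Trees* (1980), Ch. II §1.1 (neighbours of a lattice = lines of its reduction).
-/

set_option autoImplicit false

noncomputable section

open scoped Valued WithZero Matrix MatrixGroups

namespace Literature.NumberTheory.Automorphic.UnitaryLatticeTree

open Literature.NumberTheory.Automorphic Literature.NumberTheory.Automorphic.HermitianLattice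

variable {K : Type*} [Field K] [Valued K ℤᵐ⁰] {σ : K →+* K} {ϖ : K}

set_option maxHeartbeats 800000 in
-- budget only: the frame tokens are statement-heavy.
/-- **ORGAN (D) OF THE PARENT LAW: LEVEL `ϖ²` AT A SELF-DUAL VERTEX ⇒ LEVEL `ϖ` AT EVERY VERTEX AT DISTANCE `≤ 2`.**  For `γ ∈ U(σ, J₀)`, a self-dual vertex `v` with
`(γ − 1)·v ⊆ ϖ²·v`, and `v ~ c ~ w`: `(γ − 1)·w ⊆ ϖ·w` (at even depth the residual matrix is `J₀`-alternating, its corner vanishes, and the level drops by exactly one along the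
two steps `v → c → w`). [cite: BruhatTits1972, §10] [cite: Tits1979, §3.5] [cite: Kottwitz1986, §3] -/
theorem map_sub_one_le_scaleLattice_of_adj_adj_of_lev_sq (hσ : ∀ x, σ (σ x) = x) (hvσ : ∀ a, Valued.v (σ a) = Valued.v a) (hσϖ : σ ϖ = -ϖ)
    (hϖ : Valued.v ϖ = WithZero.exp (-1 : ℤ)) (hres : ∀ x : K, Valued.v x ≤ 1 → Valued.v (σ x - x) < 1) (h2 : Valued.v (2 : K) = 1)
    (γ : unitaryGroupOfForm σ ((StdForm.antidiagonal 3).over K))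
    {v c w : {M : Submodule 𝒪[K] (Fin 3 → K) // IsVertex σ ϖ ((StdForm.antidiagonal 3).over K) M}}
    (hv : IsSelfDualLattice σ ϖ ((StdForm.antidiagonal 3).over K) v.1)
    (hlev : v.1.map ((Matrix.toLin' (((γ : GL (Fin 3) K) : Matrix (Fin 3) (Fin 3) K) - 1)).restrictScalars 𝒪[K]) ≤ scaleLattice (ϖ ^ 2) v.1)
    (hvc : (latticeGraph σ ϖ ((StdForm.antidiagonal 3).over K)).Adj v c) (hcw : (latticeGraph σ ϖ ((StdForm.antidiagonal 3).over K)).Adj c w) :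
    w.1.map ((Matrix.toLin' (((γ : GL (Fin 3) K) : Matrix (Fin 3) (Fin 3) K) - 1)).restrictScalars 𝒪[K]) ≤ scaleLattice ϖ w.1 := by
  have hϖ0 : ϖ ≠ 0 := fun h0 => by rw [h0, map_zero] at hϖ; exact WithZero.coe_ne_zero hϖ.symm
  have hϖ1 : Valued.v ϖ ≤ 1 := by rw [hϖ, ← WithZero.exp_zero]; exact WithZero.exp_le_exp.2 (by norm_num)
  -- the frame of `v`
  obtain ⟨u, hu⟩ := exists_latticeGraphIso_root_eq_of_v_two hσ hvσ hϖ h2 v hv (isSelfDualLattice_stdLattice_three_of_v hϖ)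
  subst hu
  by_cases hne : w = latticeGraphIso σ ϖ ((StdForm.antidiagonal 3).over K) u ⟨stdLattice K 3, 0, isSelfDualLattice_stdLattice_three_of_v hϖ⟩
  · -- `w = v`: the level token is monotone (`ϖ²·v ⊆ ϖ·v`)
    rw [hne]
    refine hlev.trans ?_
    rw [pow_two, ← scaleLattice_scaleLattice]
    exact scaleLattice_mono ϖ (scaleLattice_le_self_of_v_le_one hϖ1 _)
  -- `c = (uκ)·N₁`, `w = latt((uκ)·g(a,b))`
  obtain ⟨κ, hκ, a, b, ha, hb, -, hw_eq⟩ := exists_frame_of_adj_adj hσ hvσ hσϖ hϖ hres h2 u rfl hvc hcw hne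
  have hframe : latticeGraphIso σ ϖ ((StdForm.antidiagonal 3).over K) (u * κ) ⟨stdLattice K 3, 0, isSelfDualLattice_stdLattice_three_of_v hϖ⟩ =
      latticeGraphIso σ ϖ ((StdForm.antidiagonal 3).over K) u ⟨stdLattice K 3, 0, isSelfDualLattice_stdLattice_three_of_v hϖ⟩ := by
    rw [latticeGraphIso_mul_apply, latticeGraphIso_root_eq_of_mem_unitaryInt hϖ hκ]
  -- the token `LEV[v](ϖ²)` in the frame `uκ`: all entries of `(uκ)⁻¹(γ − 1)(uκ)` are `≤ |ϖ|²`
  have hY : ∀ i j, Valued.v ((((((u * κ)⁻¹ * γ * (u * κ) : unitaryGroupOfForm σ ((StdForm.antidiagonal 3).over K)) : GL (Fin 3) K) : Matrix (Fin 3) (Fin 3) K) - 1) i j) ≤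
      Valued.v ϖ ^ 2 := by
    have h := (map_pow_le_scaleLattice_latticeGraphIso_root_iff hϖ γ (u * κ) (pow_ne_zero 2 hϖ0) 1).1 (by rw [pow_one, hframe]; exact hlev)
    simpa only [pow_one, map_pow] using h
  have hM : ∀ i j, Valued.v ((((((u * κ : unitaryGroupOfForm σ ((StdForm.antidiagonal 3).over K)) : GL (Fin 3) K)⁻¹ : GL (Fin 3) K) : Matrix (Fin 3) (Fin 3) K) *
      (((γ : GL (Fin 3) K) : Matrix (Fin 3) (Fin 3) K) - 1) * (((u * κ : unitaryGroupOfForm σ ((StdForm.antidiagonal 3).over K)) : GL (Fin 3) K) : Matrix (Fin 3) (Fin 3) K)) i j) ≤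
      Valued.v ϖ ^ 2 := fun i j => by
    rw [← coe_inv_mul_mul_sub_one γ (u * κ)]; exact hY i j
  -- EVEN depth `2`: the corner `(2,0)` of the `J₀`-alternating residual matrix vanishes
  have h20 : Valued.v ((((((u * κ : unitaryGroupOfForm σ ((StdForm.antidiagonal 3).over K)) : GL (Fin 3) K)⁻¹ : GL (Fin 3) K) : Matrix (Fin 3) (Fin 3) K) *
      (((γ : GL (Fin 3) K) : Matrix (Fin 3) (Fin 3) K) - 1) * (((u * κ : unitaryGroupOfForm σ ((StdForm.antidiagonal 3).over K)) : GL (Fin 3) K) : Matrix (Fin 3) (Fin 3) K)) 2 0) ≤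
      Valued.v ϖ ^ (2 + 1) := by
    have h := v_coe_sub_one_rev_apply_le_of_even hvσ hσϖ hϖ hres h2 ((u * κ)⁻¹ * γ * (u * κ)) (d := 2) even_two (by norm_num) hY 0
    rw [coe_inv_mul_mul_sub_one γ (u * κ)] at h
    exact h
  -- ★ FILE H at `d = 2`: the level at the child frame is `≥ ϖ^{2−1}` iff the corner is `≤ |ϖ|³`
  have key := (map_sub_one_childLatt_le_scaleLattice_pred_iff hϖ ((u * κ : unitaryGroupOfForm σ ((StdForm.antidiagonal 3).over K)) : GL (Fin 3) K) (γ : GL (Fin 3) K)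
    ha hb (d := 2) (by norm_num) hM).2 h20
  rw [show (2 : ℕ) - 1 = 1 from rfl, pow_one, ← hw_eq] at key
  exact key

end Literature.NumberTheory.Automorphic.UnitaryLatticeTree

end
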